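import Mathlib
import HarnessLib
import Literature.MathematicalPhysics.QuantumLattice.GrassmannChargeScaling
import Summits.HubbardSuperconductivity.HubbardSuperconductivity.Theorems.KLProgrammeKLRegimeTwoVolumeGluedTruncation

/-!
# Route `KLProgramme` — crux K3, VL child `KLRegimeVolumeLimitV17F2` (stmt-HubbardSuperconductivity-20440), (vi) blueprint v4, the KEYED block-reduced
# two-volume defect under a LEG RESCALING compatible with the residue map — the ε-currency bridge between the spine's objects and the END door's
# (cell gate-hubbard-kl, seat hubbard-kl-k3c5-p3 g13, technique «OS-positivity-free direct assembly»; `--supports` stmt-…-20440)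

The doubled tower identity the (vi) spine iterates (`…TwoVolumeDoubledTowerStep.map_doubleRows_effAction_eq_map_doubleBlock_effAction`) is stated for the
analysis matrix `Mx = [ε • E_n on copy 0 ; B on copy 1]` (`ε = imagTimeWeight β M`: the reproducing identity `S(F̃)·(ε•E(F)) = 𝟙` carries the time weight),
whereas the END door (`…VolumeLimitV9GluedDefectDoor.stub_vl_nestedFramed_of_gluedDefect_keyed`) and token #24 (`…TwoVolumeSourceProfileDefs.klSrcAction`,
`klSrcPinnedSum` with the explicit prefactor `ε^{m−1}`) read the UNWEIGHTED doubled analysis `klSrcAnalysis = [E_n ; E_plain]`.  The two differ by the leg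
rescaling `S_c = ExteriorAlgebra.map (LinearMap.mulLeft c)` with the COPY weight `c = (copy 0 ↦ ε, copy 1 ↦ 1)` (`GrassmannChargeScaling.kernel_map_mulLeft`:
`kernel (S_c A) m X = (∏ᵢ c (X i)) · kernel A m X`); a copy weight is compatible with the residue map of the doubled block structure (the residue keeps the
copy index, `…TwoVolumeGluedTruncation.snd_snd_doubledEquiv`).  This file records, generically and then on the chain's label types:

* §1 (any finite `Γ′ Γ ι`, `ed : Γ′ ≃ ι × Γ`, weights `c′`/`c` with `c (ed x).2 = c′ x`): **`keyedGlued_kernel_map_mulLeft_eq`** — the keyed block-reduced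
  defect of `(S_{c′} A′, S_c A)` at the string `X` is EXACTLY `(∏ᵢ c′ (X i)) ·` that of `(A′, A)`; its norm form; the two one-sided consequences
  `sum_norm_keyedGlued_map_mulLeft_le_mul` (`≤ K ·` if `∏ ‖c′‖ ≤ K` on the set) and `mul_sum_norm_keyedGlued_le_sum_map_mulLeft` (`k ·` originals `≤`
  rescaled if `k ≤ ∏ ‖c′‖` on the set); and the matrix bridge `map_toLin'_eq_map_mulLeft_map_of_rowScale` (`map (toLin′ Mx) W = S_c (map (toLin′ N) W)`
  whenever `Mx p X = c p · N p X`) that turns the tower identity's `[ε•E ; B]`-analysed action into `S_c` of the `[E ; B]`-analysed one;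
* §2 (decorated legs `((T × 𝕋_{L″}) × S) × C`, doubled structure `hed`): copy weights `c = w ∘ (·.2)` are compatible (`copyWeight_keyedResidue_eq`);
* §3 (M3d's label types `(SpaceTimeIdx V M × SectorLeg N) × Fin 2`, the END door's degree `2` and source pin at leg `0`): with the ALIVE weight
  `aliveWt ε = (copy 0 ↦ ε, copy 1 ↦ 1)`, `0 ≤ ε ≤ 1`, **`twoEps_sum_filter_norm_keyedGlued_le_two_sum_aliveWt`**:
  `2ε · Σ_{X : X 0 = src pin} ‖defect(A′, A) X‖ ≤ 2 · Σ_{X : X 0 = src pin} ‖defect(S A′, S A) X‖` — so a spine run on the `ε`-weighted objects closes the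
  END door's `2ε·GLUED ≤ δ` from its own `2·GLUED_ε ≤ δ`.

Proofs only (`kernel_map_mulLeft`, finite sums); no definition except the abbreviation-free weight written inline; nothing about the model's sizes is asserted.
References: BGM 2006 §2.7 (2.70)–(2.71), §2.9 (4.3)–(4.8) (the `ε`-normalised sector resolution and the external-field legs); Salmhofer 1999 §4.3 (4.95).
-/

noncomputable section

namespace Summit.HubbardSuperconductivity.HubbardSuperconductivity.Theorems.TwoVolumeDefect

set_option linter.dupNamespace false -- summit = problem name (single-conjunct summit), D-0017

open Finset Literature.MathematicalPhysics.QuantumLattice GrassmannAlgebra Literature.Probability.LatticeModels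

/-! ## §1 The keyed block-reduced defect under a compatible leg rescaling (generic) -/

section Rescale

variable {𝕜 : Type*} [RCLike 𝕜] {Γ Γ' ι : Type*} [DecidableEq ι] (ed : Γ' ≃ ι × Γ) (c : Γ → 𝕜) (c' : Γ' → 𝕜)

omit [DecidableEq ι] in
/-- Compatible weights give the residue string the weight of the string. [folklore] -/
theorem prod_legWeight_keyedResidue_eq (hc : ∀ x, c (ed x).2 = c' x) {m : ℕ} (X : Fin m → Γ') :
    (∏ i, c (ed (X i)).2) = ∏ i, c' (X i) :=
  prod_congr rfl fun i _ => hc (X i)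

/-- **The keyed block-reduced defect of the rescaled pair is the string weight times that of the pair** (exact identity).
[cite: BenfattoGiulianiMastropietro2006, §2.9 (4.6)-(4.8)] -/
theorem keyedGlued_kernel_map_mulLeft_eq (hc : ∀ x, c (ed x).2 = c' x) (A' : GrassmannAlgebra 𝕜 Γ') (A : GrassmannAlgebra 𝕜 Γ)
    {m : ℕ} (p : Fin m) (X : Fin m → Γ') :
    kernel 𝕜 (ExteriorAlgebra.map (LinearMap.mulLeft 𝕜 c') A') m X -
        (if ∀ i, (ed (X i)).1 = (ed (X p)).1 then kernel 𝕜 (ExteriorAlgebra.map (LinearMap.mulLeft 𝕜 c) A) m (fun i => (ed (X i)).2) else 0) =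
      (∏ i, c' (X i)) * (kernel 𝕜 A' m X - (if ∀ i, (ed (X i)).1 = (ed (X p)).1 then kernel 𝕜 A m (fun i => (ed (X i)).2) else 0)) := by
  rw [kernel_map_mulLeft, kernel_map_mulLeft, prod_legWeight_keyedResidue_eq ed c c' hc X]
  split_ifs <;> ring

/-- Norm form of the rescaling identity. [cite: BenfattoGiulianiMastropietro2006, §2.9 (4.6)-(4.8)] -/
theorem norm_keyedGlued_kernel_map_mulLeft_eq (hc : ∀ x, c (ed x).2 = c' x) (A' : GrassmannAlgebra 𝕜 Γ') (A : GrassmannAlgebra 𝕜 Γ)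
    {m : ℕ} (p : Fin m) (X : Fin m → Γ') :
    ‖kernel 𝕜 (ExteriorAlgebra.map (LinearMap.mulLeft 𝕜 c') A') m X -
        (if ∀ i, (ed (X i)).1 = (ed (X p)).1 then kernel 𝕜 (ExteriorAlgebra.map (LinearMap.mulLeft 𝕜 c) A) m (fun i => (ed (X i)).2) else 0)‖ =
      (∏ i, ‖c' (X i)‖) * ‖kernel 𝕜 A' m X - (if ∀ i, (ed (X i)).1 = (ed (X p)).1 then kernel 𝕜 A m (fun i => (ed (X i)).2) else 0)‖ := by
  rw [keyedGlued_kernel_map_mulLeft_eq ed c c' hc A' A p X, norm_mul, norm_prod]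

/-- **Rescaled ≤ K · original** over any finite set of strings on which the string weight is at most `K`. [folklore] -/
theorem sum_norm_keyedGlued_map_mulLeft_le_mul (hc : ∀ x, c (ed x).2 = c' x) (A' : GrassmannAlgebra 𝕜 Γ') (A : GrassmannAlgebra 𝕜 Γ)
    {m : ℕ} (p : Fin m) (s : Finset (Fin m → Γ')) {K : ℝ} (hK : ∀ X ∈ s, (∏ i, ‖c' (X i)‖) ≤ K) :
    ∑ X ∈ s, ‖kernel 𝕜 (ExteriorAlgebra.map (LinearMap.mulLeft 𝕜 c') A') m X -
        (if ∀ i, (ed (X i)).1 = (ed (X p)).1 then kernel 𝕜 (ExteriorAlgebra.map (LinearMap.mulLeft 𝕜 c) A) m (fun i => (ed (X i)).2) else 0)‖ ≤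
      K * ∑ X ∈ s, ‖kernel 𝕜 A' m X - (if ∀ i, (ed (X i)).1 = (ed (X p)).1 then kernel 𝕜 A m (fun i => (ed (X i)).2) else 0)‖ := by
  rw [mul_sum]
  refine sum_le_sum fun X hX => ?_
  rw [norm_keyedGlued_kernel_map_mulLeft_eq ed c c' hc A' A p X]
  exact mul_le_mul_of_nonneg_right (hK X hX) (norm_nonneg _)

/-- **k · original ≤ rescaled** over any finite set of strings on which the string weight is at least `k`. [folklore] -/
theorem mul_sum_norm_keyedGlued_le_sum_map_mulLeft (hc : ∀ x, c (ed x).2 = c' x) (A' : GrassmannAlgebra 𝕜 Γ') (A : GrassmannAlgebra 𝕜 Γ)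
    {m : ℕ} (p : Fin m) (s : Finset (Fin m → Γ')) {k : ℝ} (hk : ∀ X ∈ s, k ≤ ∏ i, ‖c' (X i)‖) :
    k * ∑ X ∈ s, ‖kernel 𝕜 A' m X - (if ∀ i, (ed (X i)).1 = (ed (X p)).1 then kernel 𝕜 A m (fun i => (ed (X i)).2) else 0)‖ ≤
      ∑ X ∈ s, ‖kernel 𝕜 (ExteriorAlgebra.map (LinearMap.mulLeft 𝕜 c') A') m X -
        (if ∀ i, (ed (X i)).1 = (ed (X p)).1 then kernel 𝕜 (ExteriorAlgebra.map (LinearMap.mulLeft 𝕜 c) A) m (fun i => (ed (X i)).2) else 0)‖ := by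
  rw [mul_sum]
  refine sum_le_sum fun X hX => ?_
  rw [norm_keyedGlued_kernel_map_mulLeft_eq ed c c' hc A' A p X]
  exact mul_le_mul_of_nonneg_right (hk X hX) (norm_nonneg _)

omit [DecidableEq ι] in
/-- **Matrix bridge**: analysing by a ROW-SCALED matrix `Mx p X = c p · N p X` is rescaling the legs after analysing by `N` — this turns the doubled tower
identity's `[ε • E ; B]`-analysed action into `S_c` of the `[E ; B]`-analysed one. [folklore] -/
theorem map_toLin'_eq_map_mulLeft_map_of_rowScale {Γ₁ : Type*} [Fintype Γ₁] [DecidableEq Γ₁] (cw : Γ' → 𝕜) (Mx N : Matrix Γ' Γ₁ 𝕜)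
    (hMx : ∀ p X, Mx p X = cw p * N p X) (W : GrassmannAlgebra 𝕜 Γ₁) :
    ExteriorAlgebra.map (Matrix.toLin' Mx) W = ExteriorAlgebra.map (LinearMap.mulLeft 𝕜 cw) (ExteriorAlgebra.map (Matrix.toLin' N) W) := by
  rw [← AlgHom.comp_apply, ExteriorAlgebra.map_comp_map]
  congr 2
  refine LinearMap.ext fun v => funext fun p => ?_
  simp only [LinearMap.coe_comp, Function.comp_apply, Matrix.toLin'_apply, LinearMap.mulLeft_apply, Pi.mul_apply, Matrix.mulVec,
    dotProduct, mul_sum, hMx, mul_assoc]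

end Rescale

/-! ## §2 Copy weights on decorated (doubled) legs are compatible with the residue -/

section CopyWeight

variable {𝕜 : Type*} [RCLike 𝕜] {b L Lf : ℕ} {T S C : Type*}
  (e : (T × TorusSite 2 Lf) × S ≃ (Fin 2 → Fin b) × ((T × TorusSite 2 L) × S))
  (ed : ((T × TorusSite 2 Lf) × S) × C ≃ (Fin 2 → Fin b) × (((T × TorusSite 2 L) × S) × C))

omit [RCLike 𝕜] in
/-- A weight depending only on the decoration (copy index) is compatible with the residue map of the doubled block structure. [folklore] -/
theorem copyWeight_keyedResidue_eq (hed : ∀ x s, ed (x, s) = ((e x).1, ((e x).2, s))) (w : C → 𝕜) (X' : ((T × TorusSite 2 Lf) × S) × C) :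
    (fun Y : ((T × TorusSite 2 L) × S) × C => w Y.2) (ed X').2 = (fun Y : ((T × TorusSite 2 Lf) × S) × C => w Y.2) X' := by
  simp only [snd_snd_doubledEquiv e ed hed]

/-- **Copy-weight rescaling of the keyed defect on decorated legs** (exact identity): the defect of the copy-rescaled pair at `X` is
`(∏ᵢ w ((X i).2)) ·` the defect of the pair. [cite: BenfattoGiulianiMastropietro2006, §2.9 (4.6)-(4.8)] -/
theorem keyedGlued_kernel_map_copyWeight_eq (hed : ∀ x s, ed (x, s) = ((e x).1, ((e x).2, s))) (w : C → 𝕜)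
    (A' : GrassmannAlgebra 𝕜 (((T × TorusSite 2 Lf) × S) × C)) (A : GrassmannAlgebra 𝕜 (((T × TorusSite 2 L) × S) × C))
    {m : ℕ} (p : Fin m) (X : Fin m → ((T × TorusSite 2 Lf) × S) × C) :
    kernel 𝕜 (ExteriorAlgebra.map (LinearMap.mulLeft 𝕜 (fun Y : ((T × TorusSite 2 Lf) × S) × C => w Y.2)) A') m X -
        (if ∀ i, (ed (X i)).1 = (ed (X p)).1 then
          kernel 𝕜 (ExteriorAlgebra.map (LinearMap.mulLeft 𝕜 (fun Y : ((T × TorusSite 2 L) × S) × C => w Y.2)) A) m (fun i => (ed (X i)).2) else 0) =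
      (∏ i, w (X i).2) * (kernel 𝕜 A' m X - (if ∀ i, (ed (X i)).1 = (ed (X p)).1 then kernel 𝕜 A m (fun i => (ed (X i)).2) else 0)) :=
  keyedGlued_kernel_map_mulLeft_eq ed (fun Y : ((T × TorusSite 2 L) × S) × C => w Y.2) (fun Y : ((T × TorusSite 2 Lf) × S) × C => w Y.2)
    (copyWeight_keyedResidue_eq e ed hed w) A' A p X

end CopyWeight

/-! ## §3 The END door's degree `2`, source pin at leg `0`: the alive weight `(copy 0 ↦ ε, copy 1 ↦ 1)` costs at most one factor `ε` -/

section AliveWeight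

open Summit.HubbardSuperconductivity.HubbardSuperconductivity.Theorems.TwoVolumeSource

variable {b L Lf M N : ℕ} [NeZero Lf]
  (e : (SpaceTimeIdx Lf M × SectorLeg N) ≃ (Fin 2 → Fin b) × (SpaceTimeIdx L M × SectorLeg N))
  (ed : ((SpaceTimeIdx Lf M × SectorLeg N) × Fin 2) ≃ (Fin 2 → Fin b) × ((SpaceTimeIdx L M × SectorLeg N) × Fin 2))

/-- The alive weight of a copy index: `ε` on copy `0` (alive, sector-analysed legs), `1` on copy `1` (source legs). [folklore] -/
theorem norm_aliveWt_ge {ε : ℝ} (hε0 : 0 ≤ ε) (hε1 : ε ≤ 1) (s : Fin 2) : ε ≤ ‖(if s = 0 then (ε : ℂ) else 1)‖ := by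
  split_ifs
  · rw [Complex.norm_real, Real.norm_of_nonneg hε0]
  · rw [norm_one]; exact hε1

/-- For a degree-`2` string pinned at a SOURCE leg `0`, the alive string weight is at least `ε` (the pinned factor is `1`, the other is `ε` or `1`).
[folklore] -/
theorem le_prod_norm_aliveWt_of_pin {ε : ℝ} (hε0 : 0 ≤ ε) (hε1 : ε ≤ 1) {Γ₀ : Type*} (X : Fin 2 → Γ₀ × Fin 2) (hX : (X 0).2 = 1) :
    ε ≤ ∏ i, ‖(if (X i).2 = 0 then (ε : ℂ) else 1)‖ := by
  rw [Fin.prod_univ_two, hX, if_neg (by decide), norm_one, one_mul]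
  exact norm_aliveWt_ge hε0 hε1 (X 1).2

/-- **THE END DOOR'S `2ε·GLUED` FROM THE `ε`-WEIGHTED SPINE OBJECTS**: on M3d's doubled sector-field legs, for the alive weight `(copy 0 ↦ ε, copy 1 ↦ 1)`,
`0 ≤ ε ≤ 1`, and the sum over degree-`2` strings pinned at a source leg `w` (`w.2 = 1`) at slot `0`:
`2ε · Σ ‖defect(A′, A)‖ ≤ 2 · Σ ‖defect(S A′, S A)‖`. [cite: BenfattoGiulianiMastropietro2006, §2.9 (4.6)-(4.8)] -/
theorem twoEps_sum_filter_norm_keyedGlued_le_two_sum_aliveWt (hed : ∀ x s, ed (x, s) = ((e x).1, ((e x).2, s))) {ε : ℝ} (hε0 : 0 ≤ ε) (hε1 : ε ≤ 1)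
    (A' : GrassmannAlgebra ℂ ((SpaceTimeIdx Lf M × SectorLeg N) × Fin 2)) (A : GrassmannAlgebra ℂ ((SpaceTimeIdx L M × SectorLeg N) × Fin 2))
    (w : (SpaceTimeIdx Lf M × SectorLeg N) × Fin 2) (hw : w.2 = 1) :
    2 * ε * ∑ X ∈ univ.filter (fun X : Fin 2 → (SpaceTimeIdx Lf M × SectorLeg N) × Fin 2 => X 0 = w),
        ‖kernel ℂ A' 2 X - (if ∀ i, (ed (X i)).1 = (ed (X 0)).1 then kernel ℂ A 2 (fun i => (ed (X i)).2) else 0)‖ ≤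
      2 * ∑ X ∈ univ.filter (fun X : Fin 2 → (SpaceTimeIdx Lf M × SectorLeg N) × Fin 2 => X 0 = w),
        ‖kernel ℂ (ExteriorAlgebra.map (LinearMap.mulLeft ℂ
              (fun Y : (SpaceTimeIdx Lf M × SectorLeg N) × Fin 2 => if Y.2 = 0 then (ε : ℂ) else 1)) A') 2 X -
          (if ∀ i, (ed (X i)).1 = (ed (X 0)).1 then
            kernel ℂ (ExteriorAlgebra.map (LinearMap.mulLeft ℂ
              (fun Y : (SpaceTimeIdx L M × SectorLeg N) × Fin 2 => if Y.2 = 0 then (ε : ℂ) else 1)) A) 2 (fun i => (ed (X i)).2) else 0)‖ := by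
  rw [mul_assoc]
  refine mul_le_mul_of_nonneg_left ?_ (by norm_num)
  refine mul_sum_norm_keyedGlued_le_sum_map_mulLeft ed (fun Y : (SpaceTimeIdx L M × SectorLeg N) × Fin 2 => if Y.2 = 0 then (ε : ℂ) else 1)
    (fun Y : (SpaceTimeIdx Lf M × SectorLeg N) × Fin 2 => if Y.2 = 0 then (ε : ℂ) else 1)
    (copyWeight_keyedResidue_eq e ed hed (fun s : Fin 2 => if s = 0 then (ε : ℂ) else 1)) A' A 0 _ fun X hX => ?_
  simp only [mem_filter, mem_univ, true_and] at hX
  exact le_prod_norm_aliveWt_of_pin hε0 hε1 X (by rw [hX, hw])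

/-- The same with the spine's bound carried: `2·GLUED_ε ≤ δ` for the `ε`-weighted pair gives the END door's `2ε·GLUED ≤ δ` for the unweighted pair.
[cite: BenfattoGiulianiMastropietro2006, §2.9 (4.6)-(4.8)] -/
theorem twoEps_sum_filter_norm_keyedGlued_le_of_aliveWt (hed : ∀ x s, ed (x, s) = ((e x).1, ((e x).2, s))) {ε : ℝ} (hε0 : 0 ≤ ε) (hε1 : ε ≤ 1)
    (A' : GrassmannAlgebra ℂ ((SpaceTimeIdx Lf M × SectorLeg N) × Fin 2)) (A : GrassmannAlgebra ℂ ((SpaceTimeIdx L M × SectorLeg N) × Fin 2))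
    (w : (SpaceTimeIdx Lf M × SectorLeg N) × Fin 2) (hw : w.2 = 1) {δ : ℝ}
    (hδ : 2 * ∑ X ∈ univ.filter (fun X : Fin 2 → (SpaceTimeIdx Lf M × SectorLeg N) × Fin 2 => X 0 = w),
        ‖kernel ℂ (ExteriorAlgebra.map (LinearMap.mulLeft ℂ
              (fun Y : (SpaceTimeIdx Lf M × SectorLeg N) × Fin 2 => if Y.2 = 0 then (ε : ℂ) else 1)) A') 2 X -
          (if ∀ i, (ed (X i)).1 = (ed (X 0)).1 then
            kernel ℂ (ExteriorAlgebra.map (LinearMap.mulLeft ℂ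
              (fun Y : (SpaceTimeIdx L M × SectorLeg N) × Fin 2 => if Y.2 = 0 then (ε : ℂ) else 1)) A) 2 (fun i => (ed (X i)).2) else 0)‖ ≤ δ) :
    2 * ε * ∑ X ∈ univ.filter (fun X : Fin 2 → (SpaceTimeIdx Lf M × SectorLeg N) × Fin 2 => X 0 = w),
        ‖kernel ℂ A' 2 X - (if ∀ i, (ed (X i)).1 = (ed (X 0)).1 then kernel ℂ A 2 (fun i => (ed (X i)).2) else 0)‖ ≤ δ :=
  (twoEps_sum_filter_norm_keyedGlued_le_two_sum_aliveWt e ed hed hε0 hε1 A' A w hw).trans hδ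

end AliveWeight

end Summit.HubbardSuperconductivity.HubbardSuperconductivity.Theorems.TwoVolumeDefect

end
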